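import Mathlib
import HarnessLib

/-!
# Algorithm 1 for `SU(N)`, every `N`: `N` eigen-phases of sum zero, off the walls, are carried by a unique lattice shift of sum zero into a unique Weyl chamber of the alcove

HONEST FRAMING: exact (Metropolis-corrected) sampling algorithms for lattice gauge theory;
figures of merit are autocorrelation/cost numbers at stated couplings and volumes; no
continuum-physics claim.

Venture `LatticeQCDFlow` (cell pub-lqcd), topic `Exactness`; FANOUT row 10 (`eng-equiv`, engine
`latflow.equiv` `spectral.canonicalise` / `uncanonicalise` for general `N`, Boyda et al., PRD 103 (2021)
074504, App. B Algorithm 1).  NEW WORK of the cell: the `N`-phase version of `SU3AlcoveCover.lean`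
(there `N = 3`), elementary real analysis over Mathlib (`toIcoMod` / `toIcoDiv`, `Tuple.sort`,
`Tuple.unique_monotone`).  Nothing is cited as a fact; no number; no definition.  The combinatorial
heart of the `N ≥ 4` alcove programme (LEANMAP-eng-equiv-gen9 §C″): the `N!` chambers tile the plane
`Σ y = 0` under the sum-zero lattice, up to the walls.  A simplification over the `N = 3` file: reducing
the phases into `[0, c)` (not `(−c/2, c/2]`) makes `S = −Σ(reduced)/c ∈ {0, …, N−1}` one-signed, so the
shift is always "subtract `c` from the `S` largest reduced phases" — one case.

## What is typed (period `c > 0`; `y : Fin (n+1) → ℝ`; the SORTED CHAIN of `y` along `τ` is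
`StrictMono (y ∘ τ)` together with `y (τ last) < y (τ 0) + c`)

* `exists_perm_sortedChain_of_pairwise` — pairwise distinct reals at pairwise distances `< c` are
  in the sorted chain along `Tuple.sort`;
* `injective_of_strictMono_perm`, `abs_sub_lt_of_sortedChain` — conversely;
* **`perm_eq_of_strictMono_perm`** — the chamber is unique;
* **`latticeShift_eq_zero_of_pairwise_fin`** — UNIQUENESS of the sum-zero lattice shift;
* **`exists_latticeShift_pairwise_fin`**, **`exists_latticeShift_sortedChain`** — EXISTENCE
  (Algorithm 1): off the walls and with `Σ y = 0` there is `m ∈ ℤ^{n+1}`, `Σ m = 0`, with `y + c·m`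
  pairwise distinct at pairwise distances `< c`, hence in a chamber.

NOT here: the measure-theoretic reading and the torus for `N ≥ 4`; any number.
-/

noncomputable section

namespace Summit.Ventures.LatticeQCDFlow.Exactness

open Finset

/-! ## Sorted chains -/

/-- **Pairwise distinct reals at pairwise distances `< c` are in the sorted chain**: along
`τ = Tuple.sort y`, `y ∘ τ` is strictly increasing and `y (τ last) < y (τ 0) + c`. -/
theorem exists_perm_sortedChain_of_pairwise {n : ℕ} {c : ℝ} (y : Fin (n + 1) → ℝ)
    (hne : ∀ i j, i ≠ j → y i ≠ y j) (hlt : ∀ i j, |y i - y j| < c) :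
    ∃ τ : Equiv.Perm (Fin (n + 1)), StrictMono (y ∘ τ) ∧ y (τ (Fin.last n)) < y (τ 0) + c := by
  have hinj : Function.Injective y := fun i j h => by
    by_contra hij
    exact hne i j hij h
  refine ⟨Tuple.sort y, (Tuple.monotone_sort y).strictMono_of_injective (hinj.comp (Tuple.sort y).injective), ?_⟩
  have h := (abs_sub_lt_iff.mp (hlt (Tuple.sort y (Fin.last n)) (Tuple.sort y 0))).1
  linarith

/-- **A sorted chain has pairwise distinct entries.** -/
theorem injective_of_strictMono_perm {n : ℕ} {y : Fin (n + 1) → ℝ} {τ : Equiv.Perm (Fin (n + 1))}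
    (hmono : StrictMono (y ∘ τ)) : Function.Injective y := by
  intro i j hij
  have h := hmono.injective (a₁ := τ.symm i) (a₂ := τ.symm j)
    (by simpa only [Function.comp_apply, Equiv.apply_symm_apply] using hij)
  simpa using congrArg τ h

/-- Along a sorted chain every value lies between the first and the last. -/
theorem mem_Icc_of_strictMono_perm {n : ℕ} {y : Fin (n + 1) → ℝ} {τ : Equiv.Perm (Fin (n + 1))}
    (hmono : StrictMono (y ∘ τ)) (i : Fin (n + 1)) : y (τ 0) ≤ y i ∧ y i ≤ y (τ (Fin.last n)) := by
  obtain ⟨k, rfl⟩ : ∃ k, τ k = i := ⟨τ.symm i, τ.apply_symm_apply i⟩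
  exact ⟨hmono.monotone (Fin.zero_le k), hmono.monotone (Fin.le_last k)⟩

/-- **A sorted chain has pairwise distances `< c`.** -/
theorem abs_sub_lt_of_sortedChain {n : ℕ} {c : ℝ} {y : Fin (n + 1) → ℝ} {τ : Equiv.Perm (Fin (n + 1))}
    (hmono : StrictMono (y ∘ τ)) (hlast : y (τ (Fin.last n)) < y (τ 0) + c) (i j : Fin (n + 1)) :
    |y i - y j| < c := by
  obtain ⟨hi0, hi2⟩ := mem_Icc_of_strictMono_perm hmono i
  obtain ⟨hj0, hj2⟩ := mem_Icc_of_strictMono_perm hmono j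
  rw [abs_sub_lt_iff]
  constructor <;> linarith

/-- **The chamber of a point is unique**: if `y ∘ τ` and `y ∘ τ'` are both strictly increasing then
`τ = τ'` — the `(n+1)!` chambers are pairwise disjoint. -/
theorem perm_eq_of_strictMono_perm {n : ℕ} {y : Fin (n + 1) → ℝ} {τ τ' : Equiv.Perm (Fin (n + 1))}
    (hmono : StrictMono (y ∘ τ)) (hmono' : StrictMono (y ∘ τ')) : τ = τ' := by
  have heq := Tuple.unique_monotone hmono.monotone hmono'.monotone
  have hinj := injective_of_strictMono_perm hmono
  ext i
  have hi := congr_fun heq i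
  simp only [Function.comp_apply] at hi
  exact congrArg Fin.val (hinj hi)

/-! ## Uniqueness of the lattice shift -/

/-- **Uniqueness of the sum-zero lattice shift** (any number of phases): if `y` and `y + c·m`
(`m ∈ ℤ^{n+1}`, `Σ m = 0`) both have pairwise distances `< c`, then `m = 0`. -/
theorem latticeShift_eq_zero_of_pairwise_fin {n : ℕ} {c : ℝ} (hc : 0 < c) {y : Fin (n + 1) → ℝ}
    {m : Fin (n + 1) → ℤ} (hm : ∑ i, m i = 0) (hy : ∀ i j, |y i - y j| < c)
    (hy' : ∀ i j, |(y i + m i * c) - (y j + m j * c)| < c) : m = 0 := by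
  have key : ∀ i j, 1 ≤ m i → m j ≤ -1 → False := by
    intro i j hi hj
    have h1 := (abs_sub_lt_iff.mp (hy i j)).2
    have h2 := (abs_sub_lt_iff.mp (hy' i j)).1
    have hi' : (1 : ℝ) ≤ m i := by exact_mod_cast hi
    have hj' : (m j : ℝ) ≤ -1 := by exact_mod_cast hj
    have h2c : 2 * c ≤ ((m i : ℝ) - m j) * c := mul_le_mul_of_nonneg_right (by linarith) hc.le
    nlinarith
  by_contra hne
  obtain ⟨i, hi⟩ : ∃ i, m i ≠ 0 := by
    by_contra h
    push Not at h
    exact hne (funext h)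
  rcases lt_or_gt_of_ne hi with hneg | hpos
  · obtain ⟨j, hj⟩ : ∃ j, 0 < m j := by
      by_contra h
      push Not at h
      have hall := (Finset.sum_eq_zero_iff_of_nonpos (s := Finset.univ) (f := m) fun k _ => h k).mp hm
      exact hi (hall i (Finset.mem_univ i))
    exact key j i (by omega) (by omega)
  · obtain ⟨j, hj⟩ : ∃ j, m j < 0 := by
      by_contra h
      push Not at h
      have hall := (Finset.sum_eq_zero_iff_of_nonneg (s := Finset.univ) (f := m) fun k _ => h k).mp hm
      exact hi (hall i (Finset.mem_univ i))
    exact key i j (by omega) (by omega)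

/-! ## Existence of the lattice shift (Algorithm 1), every `N` -/

/-- Off the walls, every lattice shift keeps the phases pairwise distinct. -/
theorem latticeShift_ne_of_offWalls_fin {n : ℕ} {c : ℝ} {y : Fin (n + 1) → ℝ}
    (hties : ∀ i j, i ≠ j → ∀ k : ℤ, y i - y j ≠ k * c) (m : Fin (n + 1) → ℤ) (i j : Fin (n + 1)) (hij : i ≠ j) :
    y i + m i * c ≠ y j + m j * c := by
  intro h
  refine hties i j hij (m j - m i) ?_
  push_cast
  linarith

/-- **Existence of the sum-zero lattice shift (Algorithm 1, every `N`).**  Let `Σ y = 0` and let no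
difference `y i − y j`, `i ≠ j`, be an integer multiple of `c`.  Then some `m ∈ ℤ^{n+1}` with `Σ m = 0`
makes `y + c·m` pairwise distinct with pairwise distances `< c`.  Construction: reduce each phase into
`[0, c)`; then `S = −Σ(reduced)/c ∈ {0, …, n}`; subtract `c` from the `S` largest reduced phases. -/
theorem exists_latticeShift_pairwise_fin {n : ℕ} {c : ℝ} (hc : 0 < c) {y : Fin (n + 1) → ℝ}
    (hsum : ∑ i, y i = 0) (hties : ∀ i j, i ≠ j → ∀ k : ℤ, y i - y j ≠ k * c) :
    ∃ m : Fin (n + 1) → ℤ, ∑ i, m i = 0 ∧ (∀ i j, i ≠ j → y i + m i * c ≠ y j + m j * c) ∧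
      ∀ i j, |(y i + m i * c) - (y j + m j * c)| < c := by
  -- reduction of each phase into `[0, c)`
  set nn : Fin (n + 1) → ℤ := fun i => toIcoDiv hc 0 (y i) with hnn
  set r : Fin (n + 1) → ℝ := fun i => toIcoMod hc 0 (y i) with hr
  have hr_mem : ∀ i, 0 ≤ r i ∧ r i < c := by
    intro i
    have h := toIcoMod_mem_Ico hc 0 (y i)
    rw [zero_add] at h
    exact h
  have hr_eq : ∀ i, r i = y i + (-nn i : ℤ) * c := by
    intro i
    have h := toIcoMod_add_toIcoDiv_zsmul hc 0 (y i)
    rw [zsmul_eq_mul] at h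
    push_cast
    simp only [hr, hnn]
    linarith
  have hr_ne : ∀ i j, i ≠ j → r i ≠ r j := by
    intro i j hij
    rw [hr_eq, hr_eq]
    exact latticeShift_ne_of_offWalls_fin hties (fun i => -nn i) i j hij
  have hr_lt : ∀ i j, |r i - r j| < c := by
    intro i j
    obtain ⟨hi1, hi2⟩ := hr_mem i
    obtain ⟨hj1, hj2⟩ := hr_mem j
    rw [abs_sub_lt_iff]
    constructor <;> linarith
  -- `Σ r = -N₀ c` with `-n ≤ N₀ ≤ 0`; `K = -N₀`
  obtain ⟨N₀, hN₀⟩ : ∃ N₀ : ℤ, ∑ i, nn i = N₀ := ⟨_, rfl⟩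
  have hsum_r : ∑ i, r i = -(N₀ : ℝ) * c := by
    have h : ∑ i, r i = ∑ i, (y i + (-nn i : ℤ) * c) := Finset.sum_congr rfl fun i _ => hr_eq i
    rw [h, Finset.sum_add_distrib, hsum, ← Finset.sum_mul, zero_add]
    congr 1
    push_cast
    rw [Finset.sum_neg_distrib, ← Int.cast_sum, hN₀]
  have hsum_lo : (0 : ℝ) ≤ ∑ i, r i := Finset.sum_nonneg fun i _ => (hr_mem i).1
  have hsum_hi : ∑ i, r i < (n + 1 : ℝ) * c := by
    calc ∑ i, r i < ∑ _i : Fin (n + 1), c := Finset.sum_lt_sum_of_nonempty Finset.univ_nonempty fun i _ => (hr_mem i).2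
      _ = (n + 1 : ℝ) * c := by simp
  have hN₀_le : N₀ ≤ 0 := by
    by_contra h
    push Not at h
    have h' : (1 : ℝ) ≤ N₀ := by exact_mod_cast h
    nlinarith
  have hN₀_ge : -(n : ℤ) ≤ N₀ := by
    by_contra h
    push Not at h
    have h' : (N₀ : ℝ) ≤ -(n : ℝ) - 1 := by
      have : N₀ ≤ -(n : ℤ) - 1 := by omega
      exact_mod_cast this
    nlinarith
  obtain ⟨K, hK⟩ : ∃ K : ℕ, (K : ℤ) = -N₀ := ⟨(-N₀).toNat, by omega⟩
  have hKn : K ≤ n := by omega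
  -- sort the reduced phases
  set σ : Equiv.Perm (Fin (n + 1)) := Tuple.sort r with hσ
  have hrinj : Function.Injective r := fun i j h => by
    by_contra hij
    exact hr_ne i j hij h
  have hmono : StrictMono (r ∘ σ) := (Tuple.monotone_sort r).strictMono_of_injective (hrinj.comp σ.injective)
  -- subtract `c` from the `K` largest: those of rank `≥ n + 1 - K`
  refine ⟨fun i => -nn i - if n + 1 - K ≤ (σ.symm i : ℕ) then 1 else 0, ?_,
    latticeShift_ne_of_offWalls_fin hties _, ?_⟩
  · -- the shift has sum zero: exactly `K` ranks are `≥ n + 1 - K`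
    rw [Finset.sum_sub_distrib, Finset.sum_neg_distrib, hN₀]
    have hcount : ∑ i : Fin (n + 1), (if n + 1 - K ≤ (σ.symm i : ℕ) then (1 : ℤ) else 0) = K := by
      rw [Equiv.sum_comp σ.symm (fun j : Fin (n + 1) => if n + 1 - K ≤ (j : ℕ) then (1 : ℤ) else 0),
        Fin.sum_univ_eq_sum_range (fun j : ℕ => if n + 1 - K ≤ j then (1 : ℤ) else 0) (n + 1),
        Finset.sum_ite, Finset.sum_const_zero, add_zero, Finset.sum_const, nsmul_eq_mul, mul_one]
      have hset : (Finset.range (n + 1)).filter (fun j => n + 1 - K ≤ j) = Finset.Ico (n + 1 - K) (n + 1) := by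
        ext j
        simp only [Finset.mem_filter, Finset.mem_range, Finset.mem_Ico]
        omega
      rw [hset, Nat.card_Ico]
      exact_mod_cast (by omega : n + 1 - (n + 1 - K) = K)
    rw [hcount, hK]
    ring
  · have hval : ∀ i, y i + ((-nn i - if n + 1 - K ≤ (σ.symm i : ℕ) then 1 else 0 : ℤ) : ℝ) * c =
        r i - if n + 1 - K ≤ (σ.symm i : ℕ) then c else 0 := by
      intro i
      rw [hr_eq i]
      split_ifs <;> push_cast <;> ring
    intro i j
    rw [hval, hval]
    -- ranks
    have hri : r i = (r ∘ σ) (σ.symm i) := by simp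
    have hrj : r j = (r ∘ σ) (σ.symm j) := by simp
    by_cases hi : n + 1 - K ≤ (σ.symm i : ℕ) <;> by_cases hj : n + 1 - K ≤ (σ.symm j : ℕ)
    · rw [if_pos hi, if_pos hj]
      have h := hr_lt i j
      rw [abs_sub_lt_iff] at h ⊢
      constructor <;> linarith [h.1, h.2]
    · rw [if_pos hi, if_neg hj]
      -- `j` has the smaller rank, so `r j < r i`
      have hlt' : r j < r i := by
        rw [hri, hrj]
        exact hmono (show σ.symm j < σ.symm i from Fin.lt_def.mpr (by omega))
      have hd := (abs_sub_lt_iff.mp (hr_lt i j)).1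
      rw [abs_sub_lt_iff]
      constructor <;> linarith
    · rw [if_neg hi, if_pos hj]
      have hlt' : r i < r j := by
        rw [hri, hrj]
        exact hmono (show σ.symm i < σ.symm j from Fin.lt_def.mpr (by omega))
      have hd := (abs_sub_lt_iff.mp (hr_lt i j)).2
      rw [abs_sub_lt_iff]
      constructor <;> linarith
    · rw [if_neg hi, if_neg hj, sub_zero, sub_zero]
      exact hr_lt i j

/-- **Algorithm 1 lands in a chamber, every `N`.**  Off the walls and with `Σ y = 0`, some sum-zero
lattice shift `m ∈ ℤ^{n+1}` and some `τ ∈ S_{n+1}` make `y + c·m` strictly increasing along `τ` with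
last-minus-first `< c` — the canonical cell up to the remembered permutation. -/
theorem exists_latticeShift_sortedChain {n : ℕ} {c : ℝ} (hc : 0 < c) {y : Fin (n + 1) → ℝ}
    (hsum : ∑ i, y i = 0) (hties : ∀ i j, i ≠ j → ∀ k : ℤ, y i - y j ≠ k * c) :
    ∃ m : Fin (n + 1) → ℤ, ∑ i, m i = 0 ∧ ∃ τ : Equiv.Perm (Fin (n + 1)),
      StrictMono ((fun i => y i + m i * c) ∘ τ) ∧
        y (τ (Fin.last n)) + m (τ (Fin.last n)) * c < y (τ 0) + m (τ 0) * c + c := by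
  obtain ⟨m, hm, hne, hlt⟩ := exists_latticeShift_pairwise_fin hc hsum hties
  obtain ⟨τ, hmono, hlast⟩ := exists_perm_sortedChain_of_pairwise (fun i => y i + m i * c) hne hlt
  exact ⟨m, hm, τ, hmono, hlast⟩

end Summit.Ventures.LatticeQCDFlow.Exactness
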